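import Summits.BirchSwinnertonDyer.BirchSwinnertonDyer.Theorems.RamifiedHeegnerPairTwistUnitAdditive
import Summits.BirchSwinnertonDyer.Rank1Residual.Additive.X4ThreeVisibleRowShapesD44_65
import HarnessLib

/-!
# U₁ / U₀ at the single-ADDITIVE-carrier Gss2 classes — part L: `238050dc1`, `282240ex1`

Continuation of `…Theorems.RamifiedHeegnerPairTwistUnitAdditive` (seat `bsd-trib-w-rhp` g13; the doors `twistUnit[Zero]TwoSplit_of_sqrtField` and the
full framing are there): per rank-zero curve `subGss_three_<label>` (Addv ∧ SubGss at `3` in the kernel), `tamRowZ_/tamagawaProduct_<label>` (`∏ c_ℓ` in the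
kernel), `localTamagawa_<q>_<label>` (`c(E/ℚ_q) = 3` in the kernel, the `hmono` input), Kraus minimality of `V = E^{(-3)}_min` and of the twist model `Wd`,
and `u1_at_/u0_at_<label> : … → MissingUpperBoundAt W 3` by rhp-p2 g9 §4 / §4₀ (`RamifiedPairUpperBound.leafRank{One,Zero}Upper_three_monoCarrierAny_of_namedFacts_…`)
with print + the three named facts `h37 hPT hF1` as hypotheses and `hN hr Dt hc` + the twist `L`-data + `#Ш(Wd)_an` DISPLAYED (+ `bsd3_at_<label>` where the
lower half is free).  **HONEST FRAMING: theorems only; per-curve certificates under DISPLAYED inputs (conductor, analytic rank, `3 ∤ c(Dt)`, twist `L`-data, `#Ш(Wd)_an`) and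
the printed / named facts of the road as hypotheses; nothing is booked, no item is closed; U₁ (26022) / U₀ (26024) / TU / L₀ / L₁ stay OPEN class-wide; BSD is
NOT proved for any curve by this file.**
[cite: MatarNekovar2019, Thm. 0.7 (p. 456)] [cite: GrossZagier1986, Thm. I.(6.3) and (7.3)] [cite: GrossLMS1991, §1 and Prop. 3.7]
[cite: KrizLi2019, Thm. 1.20] [cite: Silverman1994, IV.9.4] [cite: Tate1975, §7] [cite: Kraus1989, Prop. 1] [cite: Cremona2006, Table 1]
[cite: SilvermanAEC2009, C.11 (CM j-invariants)]
-/

set_option linter.dupNamespace false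
set_option autoImplicit false

noncomputable section

open scoped Classical NumberField

open WeierstrassCurve NumberField IsDedekindDomain IsDedekindDomain.HeightOneSpectrum Rat.HeightOneSpectrum Field Literature
  Literature.NumberTheory.DiophantineGeometry Literature.NumberTheory.EllipticCurves Literature.NumberTheory.EllipticCurves.ModularForms
  Literature.NumberTheory.EllipticCurves.Rank1Residual Literature.NumberTheory.EllipticCurves.Rank1Residual.Typed Literature.NumberTheory.Automorphic
  Literature.NumberTheory.EllipticCurves.Rank1Residual.X11RankOneCertificates Literature.NumberTheory.EllipticCurves.KrizLi2019
  Literature.NumberTheory.GaloisRepresentations Literature.NumberTheory.QuadraticFields Summit.BirchSwinnertonDyer.BirchSwinnertonDyer.Rank1Residual.IntModel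
  Summit.BirchSwinnertonDyer.BirchSwinnertonDyer.Rank2Observatory.Tam Summit.BirchSwinnertonDyer.Rank1Residual
  Summit.BirchSwinnertonDyer.Rank1Residual.Additive Summit.BirchSwinnertonDyer.Rank1Residual.X11b Summit.BirchSwinnertonDyer.Rank1Residual.X11b.Three
  Summit.BirchSwinnertonDyer.Rank1Residual.GaloisImage Summit.BirchSwinnertonDyer.Rank1Residual.Supersingular
  Summit.BirchSwinnertonDyer.BirchSwinnertonDyer.Theses.RamifiedHeegnerPair Summit.BirchSwinnertonDyer.BirchSwinnertonDyer.Theorems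
  Summit.BirchSwinnertonDyer.BirchSwinnertonDyer.Theorems.SchneiderFree Summit.BirchSwinnertonDyer.BirchSwinnertonDyer.Theorems.RamifiedPairUpperBound
  Summit.BirchSwinnertonDyer.BirchSwinnertonDyer.Theorems.RamifiedHeegnerPairStepLIntrinsic
  Summit.BirchSwinnertonDyer.BirchSwinnertonDyer.Theorems.AdditiveBranchIMCGordTwoRankOne.HeegnerKolyvagin
  Summit.BirchSwinnertonDyer.BirchSwinnertonDyer.Theorems.RamifiedHeegnerPairTwistUnitIntrinsic

namespace Summit.BirchSwinnertonDyer.BirchSwinnertonDyer.Theorems.RamifiedHeegnerPairTwistUnitAdditive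

/-! ## §21 `238050dc1` = `[1, -1, 0, -2873742, -1877479084]`, `N = 238050 = 2·3^2·5^2·23^2` (`2`: I25, `c = 1`, `3`: I₀*, `c = 1`, `5`: IV*, `c = 3`, `23`: II, `c = 1`); `∏ c_ℓ = 3`, single carrier `q = 5` (IV*, ADDITIVE, `c_5 = 3`);
`r_an = 0`, `#E(ℚ)_tors = 1`, `#Ш(E)_an = 9` (Cremona/LMFDB, displayed where used); class `238050dc` of size 1.
`V = E^{(-3)}_min = [1, -1, 1, -319305, 69642697]` (`#Ṽ(𝔽₃) = 1`), `K = ℚ(√-191)`, `Wd = E^{(-191)}_min = [1, -1, 0, -104836988742, 13087064237860916]`: `L(E^{(-191)},1) = 0` (root number `-1`), `L'(E^{(-191)},1) ≠ 0`, `X := L'(F,1)·T²/(Ω·∏c·ĥ(P)) = [F(ℚ):ℤP]²·#Ш(F)_an = 1` EXACTLY (an integer to `60` digits) with the Heegner point `P ∈ F(ℚ)` of canonical height `ĥ(P) = 14.110223` found by the level-`N` engine (g12 `heeg2.gp`, kit j312623; `N(Wd) = 8684302050 = N·191²`, `∏c(Wd) = 6`, `#Wd(ℚ)_tors = 1`),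 whence `ord₃ #Ш(Wd)_an ≤ 0`. -/

/-- `V = [1, -1, 1, -319305, 69642697]` (the minimal model of `238050dc1^{(-3)}`, conductor `26450`): `Δ ≠ 0` in the kernel. [cite: Cremona2006, Table 1 (Cremona label 238050dc1)] -/
theorem isElliptic_sV238050dc1 : (⟨1, -1, 1, -319305, 69642697⟩ : WeierstrassCurve ℚ).IsElliptic :=
  isElliptic_of_discOf_ne_zero 1 (-1) 1 (-319305) 69642697 (by decide +kernel)

/-- `V` is globally minimal: `|Δ| = 2^25·5^8·23^2` kernel-checked, Kraus' criterion prime by prime. [cite: Kraus1989, Prop. 1 and Prop. 2]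
[cite: SilvermanAEC2009, VII.1 Remark 1.1] [cite: Cremona2006, Table 1 (Cremona label 238050dc1)] -/
theorem isGloballyMinimal_sV238050dc1 : (⟨1, -1, 1, -319305, 69642697⟩ : WeierstrassCurve ℚ).IsGloballyMinimal :=
  isGloballyMinimal_of_krausCriterion₃_factored 1 (-1) 1 (-319305) 69642697
    [(2, 25), (5, 8), (23, 2)] (by decide +kernel)
    (by intro qe hqe; simp only [List.mem_cons, List.not_mem_nil, or_false] at hqe
        rcases hqe with rfl | rfl | rfl <;> norm_num)
    (by set_option synthInstance.maxSize 2000 in decide +kernel)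

/-- **`238050dc1` is ADDITIVE at `3` and on the cell (G) ∧ ss, IN THE KERNEL**: `3 ∣ Δ`, `3 ∣ c₄`; `C • V^{(-3)} = E` (`[u, r, s, t] = [1, -1, 1/2, 0]`) with
`V` globally minimal, `3 ∤ Δ(V)`, `#Ṽ(𝔽₃) = 1` (`a₃(V) = 3`, supersingular), whence `TypeG`, `SubGord`, `SubGss` at `3` as in the k1 records.
[cite: SilvermanAEC2009, VII.5 Prop. 5.1 (a), (c)] [cite: Delbourgo1998, §1.5 (G)] [cite: Cremona2006, Table 1 (Cremona label 238050dc1)] -/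
theorem subGss_three_238050dc1 {W : WeierstrassCurve ℚ} [W.IsElliptic] [W.IsGloballyMinimal] (hWeq : W = (⟨1, -1, 0, -2873742, -1877479084⟩ : WeierstrassCurve ℚ)) :
    Addv W 3 ∧ SubGss W 3 := by
  subst hWeq
  haveI := isElliptic_sV238050dc1
  haveI := isGloballyMinimal_sV238050dc1
  have hIW : integralModelInt (⟨1, -1, 0, -2873742, -1877479084⟩ : WeierstrassCurve ℚ) = (⟨1, -1, 0, -2873742, -1877479084⟩ : WeierstrassCurve ℤ) :=
    integralModelInt_eq_of_map_eq _ (map_mk_int 1 (-1) 0 (-2873742) (-1877479084))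
  have hadd : Addv (⟨1, -1, 0, -2873742, -1877479084⟩ : WeierstrassCurve ℚ) 3 := Additive.addv_of_intModel hIW 3 (by decide +kernel) (by decide +kernel)
  have hIV : integralModelInt (⟨1, -1, 1, -319305, 69642697⟩ : WeierstrassCurve ℚ) = (⟨1, -1, 1, -319305, 69642697⟩ : WeierstrassCurve ℤ) :=
    integralModelInt_eq_of_map_eq _ (map_mk_int 1 (-1) 1 (-319305) 69642697)
  have hcV : Nat.card ((((⟨1, -1, 1, -319305, 69642697⟩ : WeierstrassCurve ℤ)).map (Int.castRingHom (ZMod 3))).toAffine.Point) = 1 := by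
    have h := natCard_point_eq_countPoints 1 (-1) 1 (-319305) 69642697 3 (by norm_num) (by decide +kernel)
    have h' : countPoints [1, -1, 1, -319305, 69642697] 3 = 1 := countPoints_eq_of_fast (by decide +kernel)
    exact_mod_cast h.trans h'
  have hgood : GoodSS (⟨1, -1, 1, -319305, 69642697⟩ : WeierstrassCurve ℚ) 3 := Supersingular.goodSS_of_intModel 3 hIV (by decide +kernel) hcV (by decide)
  have hVW : (⟨1, (-1 : ℚ), ((1:ℚ)/2), (0 : ℚ)⟩ : VariableChange ℚ) • (⟨1, -1, 1, -319305, 69642697⟩ : WeierstrassCurve ℚ).quadraticTwist (-3) =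
      (⟨1, -1, 0, -2873742, -1877479084⟩ : WeierstrassCurve ℚ) := by
    ext <;> simp [WeierstrassCurve.variableChange_a₁, WeierstrassCurve.variableChange_a₂,
      WeierstrassCurve.variableChange_a₃, WeierstrassCurve.variableChange_a₄, WeierstrassCurve.variableChange_a₆,
      WeierstrassCurve.quadraticTwist, WeierstrassCurve.b₂, WeierstrassCurve.b₄, WeierstrassCurve.b₆] <;> norm_num
  obtain ⟨C, hC⟩ := exists_variableChange_quadraticTwist_symm (⟨1, -1, 0, -2873742, -1877479084⟩ : WeierstrassCurve ℚ)
    (⟨1, -1, 1, -319305, 69642697⟩ : WeierstrassCurve ℚ) (d := (-3 : ℚ)) (by norm_num) ⟨_, hVW⟩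
  have hC' : C • (⟨1, -1, 0, -2873742, -1877479084⟩ : WeierstrassCurve ℚ).quadraticTwist ((-1 : ℚ) ^ ((3 : ℕ) / 2) * (3 : ℕ)) =
      (⟨1, -1, 1, -319305, 69642697⟩ : WeierstrassCurve ℚ) := by
    rw [O5.pstar_three]; exact hC
  have hG : TypeG (⟨1, -1, 0, -2873742, -1877479084⟩ : WeierstrassCurve ℚ) 3 := (typeG_three_iff_good_twist _ hadd _ C hC').mpr hgood.1
  exact ⟨hadd, (O5.subGss_three_iff_subGord_and_goodSS_twist _ hadd _ C hC).mpr
    ⟨subGord_three_of_typeG_of_addv _ hG hadd, hgood⟩⟩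

/-- **`c(W/ℚ_5) = 3` IN THE KERNEL** (the carrier's LOCAL Tamagawa number) for any globally minimal `W / ℚ` with this model: Tate's algorithm at `5` to its
exit (type IV*, `TamX` certificate, `c = 3`) through n1011-p19's bridge `IntModelTam.localTamagawaNumber_padic_eq_of_intModel_of_tamX`; the `hmono` input of the
mono-carrier road (`ord₃ ∏ c_ℓ = 1 = ord₃ c_5`). [cite: Silverman1994, IV.9.4] [cite: Tate1975, §7] [cite: Cremona2006, Table 1 (Cremona label 238050dc1)] -/
theorem localTamagawa_five_238050dc1 {W : WeierstrassCurve ℚ} [W.IsElliptic] [W.IsGloballyMinimal]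
    (hI : integralModelInt W = (⟨1, -1, 0, -2873742, -1877479084⟩ : WeierstrassCurve ℤ)) :
    haveI : Fact (Nat.Prime 5) := ⟨by norm_num⟩
    (W.baseChange ℚ_[5]).localTamagawaNumber ℤ_[5] = 3 :=
  haveI : Fact (Nat.Prime 5) := ⟨by norm_num⟩
  (IntModelTam.localTamagawaNumber_padic_eq_of_intModel_of_tamX hI 5 (F := ⟨5, 2, 3, 19, 2, 53, 8, 1⟩) rfl (by decide +kernel)).trans (by decide)

/-- `Wd = [1, -1, 0, -104836988742, 13087064237860916]` (the minimal model of the Heegner twist `238050dc1^{(-191)}`, conductor `8684302050`): `Δ ≠ 0` in the kernel. [cite: Cremona2006, Table 1 (Cremona label 238050dc1)] -/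
theorem isElliptic_sWd238050dc1 : (⟨1, -1, 0, -104836988742, 13087064237860916⟩ : WeierstrassCurve ℚ).IsElliptic :=
  isElliptic_of_discOf_ne_zero 1 (-1) 0 (-104836988742) 13087064237860916 (by decide +kernel)

/-- `Wd` is globally minimal: `|Δ| = 2^25·3^6·5^8·23^2·191^6` kernel-checked, Kraus' criterion prime by prime. [cite: Kraus1989, Prop. 1 and Prop. 2]
[cite: SilvermanAEC2009, VII.1 Remark 1.1] [cite: Cremona2006, Table 1 (Cremona label 238050dc1)] -/
theorem isGloballyMinimal_sWd238050dc1 : (⟨1, -1, 0, -104836988742, 13087064237860916⟩ : WeierstrassCurve ℚ).IsGloballyMinimal :=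
  isGloballyMinimal_of_krausCriterion₃_factored 1 (-1) 0 (-104836988742) 13087064237860916
    [(2, 25), (3, 6), (5, 8), (23, 2), (191, 6)] (by decide +kernel)
    (by intro qe hqe; simp only [List.mem_cons, List.not_mem_nil, or_false] at hqe
        rcases hqe with rfl | rfl | rfl | rfl | rfl <;> norm_num)
    (by set_option synthInstance.maxSize 2000 in decide +kernel)

/-- **U₀ AT `238050dc1` BY THE MONO-CARRIER TWIST-UNIT ROAD** — `MissingUpperBoundAt W 3` (`ord₃ #Ш(E) ≤ ord₃ #Ш(E)_an`) at `W = E` (`r_an = 0`) from rhp-p2 g9 §4₀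
`RamifiedPairUpperBound.leafRankZeroUpper_three_monoCarrierAny_of_namedFacts_of_twistUnitZeroTwoSplit` (p646215): PRINTED binders `hGZ hKo hGZK hmod hMN hmodP hCassels`
(Gross–Zagier ∀, Kolyvagin ∀, GZK, Version L, Matar–Nekovář 2019 Thm 0.7 irreducible form, modular parametrisations exist, Cassels) and the three NAMED tree facts
`h37 hPT hF1` (GrossLMS1991 Prop. 3.7(2), Poitou–Tate for Selmer structures, Gross 1991 (4.1) — research-level, displayed BY NAME); KERNEL: `∏ c_ℓ(E) = 3`
(`Summit.BirchSwinnertonDyer.Rank1Residual.Additive.tamagawaProduct_d44_v238050dc1`) and `c(E/ℚ_5) = 3` (`localTamagawa_five_238050dc1`): `hmono` with the single ADDITIVE carrier `q = 5` (IV*); `¬ CM` (`j = -17423038164465/33554432`),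
`Addv ∧ SubGss` at `3` (`subGss_three_238050dc1`), the field `K = ℚ(√-191)` (`-191 ≡ 1 (mod 8)`; `191` prime), the twist identity
`Cd • E^{(-191)} = Wd` (`Cd = [1, -48, 1/2, 0]`), Kraus minimality of `Wd` (`isGloballyMinimal_sWd238050dc1`); DISPLAYED: `N(E) = 238050` (`hN`), `r_an(E) = 0` (`hr`), `Dt` with
`3 ∤ c(Dt)` (`hc`; Manin constant `1` for this optimal curve), `L(E^{(-191)},1) = 0` (`hL0`), `L'(E^{(-191)},1) ≠ 0` (`hL1`), `ord₃ #Ш(Wd)_an ≤ 0` (`hqd`/`hvd`; `X = 1`) — numerics in the section header.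
A per-curve certificate; U₀ (stmt 26024) stays OPEN class-wide; BSD is NOT proved by this. [cite: MatarNekovar2019, Thm. 0.7 (p. 456) and §0.11 (p. 457)]
[cite: GrossZagier1986, Thm. I.(6.3)] [cite: GrossLMS1991, Prop. 3.7] [cite: Miller2011LMS, Def. 1.1] [cite: Cremona2006, Table 1 (Cremona label 238050dc1)] -/
theorem u0_at_238050dc1
    (hGZ : ∀ (N : ℕ) [NeZero N] (W : WeierstrassCurve ℚ) (K : Type) [Field K] [NumberField K], gross_zagier N W K)
    (hKo : ∀ (N : ℕ) [NeZero N] (W : WeierstrassCurve ℚ) (K : Type) [Field K] [NumberField K], kolyvagin N W K)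
    (hGZK : rank_eq_analyticRank_of_analyticRank_le_one) (hmod : hasEntireLFunction_rat)
    (hMN : MatarNekovar2019.thm07_padicValNat_card_sha_primary_add_le_of_globalDivisibility_of_irreducible) (hmodP : nonempty_modularParametrizationData)
    (hCassels : bsdRHS_eq_of_isIsogenous) (h37 : GrossLMS1991.prop37_2_frobeniusCongruence)
    (hPT : ∀ (K : Type) [Field K] [NumberField K], Literature.NumberTheory.GaloisCohomology.poitouTate_selmerStructure_duality_conj K)
    (hF1 : Gross1991_heegnerPoint_sub_ratTorsion_mem_E0_imageFree)
    {W : WeierstrassCurve ℚ} [W.IsElliptic] [W.IsGloballyMinimal] (hWeq : W = (⟨1, -1, 0, -2873742, -1877479084⟩ : WeierstrassCurve ℚ))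
    (hN : W.conductorNorm ℤ = 238050) [NeZero (W.conductorNorm ℤ)] (hr : W.analyticRank = 0)
    (Dt : ModularParametrizationData W (W.conductorNorm ℤ)) (hc : ¬ (3 : ℤ) ∣ Dt.c)
    (hL0 : (W.quadraticTwist ((-191 : ℤ) : ℚ)).entireLFunction 1 = 0)
    (hL1 : deriv (W.quadraticTwist ((-191 : ℤ) : ℚ)).entireLFunction 1 ≠ 0)
    {qd : ℚ} (hqd : haveI := isElliptic_sWd238050dc1; shaAn (⟨1, -1, 0, -104836988742, 13087064237860916⟩ : WeierstrassCurve ℚ) = (qd : ℂ))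
    (hvd : padicValRat 3 qd ≤ 0) :
    MissingUpperBoundAt W 3 := by
  subst hWeq
  haveI := isElliptic_sWd238050dc1; haveI := isGloballyMinimal_sWd238050dc1
  haveI : Fact ((-191 : ℤ) < 0) := ⟨by norm_num⟩
  haveI : Fact (Nat.Prime 5) := ⟨by norm_num⟩
  have hjac : ∀ ℓ : ℕ, ℓ.Prime → ℓ ∣ 238050 → ℓ ≠ 2 → jacobiSym (-191) ℓ = 1 := by
    intro ℓ hℓ hℓN hℓ2
    have hmem : ℓ ∈ Nat.primeFactors 238050 := Nat.mem_primeFactors.mpr ⟨hℓ, hℓN, by norm_num⟩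
    have hpf : Nat.primeFactors 238050 = {2, 3, 5, 23} := by decide +kernel
    rw [hpf] at hmem
    simp only [Finset.mem_insert, Finset.mem_singleton] at hmem
    rcases hmem with rfl | rfl | rfl | rfl
    · exact absurd rfl hℓ2
    all_goals (rw [jacobiSym.mod_left]; norm_num [jacobiSym.mod_left])
  have hWd : (⟨1, (-48 : ℚ), ((1:ℚ)/2), (0 : ℚ)⟩ : VariableChange ℚ) •
      (⟨1, -1, 0, -2873742, -1877479084⟩ : WeierstrassCurve ℚ).quadraticTwist ((-191 : ℤ) : ℚ) =
        (⟨1, -1, 0, -104836988742, 13087064237860916⟩ : WeierstrassCurve ℚ) := by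
    push_cast
    ext <;> simp [WeierstrassCurve.variableChange_a₁, WeierstrassCurve.variableChange_a₂,
      WeierstrassCurve.variableChange_a₃, WeierstrassCurve.variableChange_a₄, WeierstrassCurve.variableChange_a₆,
      WeierstrassCurve.quadraticTwist, WeierstrassCurve.b₂, WeierstrassCurve.b₄, WeierstrassCurve.b₆] <;> norm_num
  have hTU := twistUnitZeroTwoSplit_of_sqrtField _ 238050 (-191) (by norm_num)
    (by rw [show (-191 : ℤ).natAbs = 191 by rfl, Nat.squarefree_iff_nodup_primeFactorsList (by norm_num)]; simp)
    hjac hN hL0 hL1 _ _ hWd hqd hvd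
  have hI : integralModelInt (⟨1, -1, 0, -2873742, -1877479084⟩ : WeierstrassCurve ℚ) = (⟨1, -1, 0, -2873742, -1877479084⟩ : WeierstrassCurve ℤ) :=
    integralModelInt_eq_of_map_eq _ (map_mk_int 1 (-1) 0 (-2873742) (-1877479084))
  have hmono : padicValNat 3 (⟨1, -1, 0, -2873742, -1877479084⟩ : WeierstrassCurve ℚ).tamagawaProduct ≤
      padicValNat 3 (((⟨1, -1, 0, -2873742, -1877479084⟩ : WeierstrassCurve ℚ).baseChange ℚ_[5]).localTamagawaNumber ℤ_[5]) := by
    rw [Summit.BirchSwinnertonDyer.Rank1Residual.Additive.tamagawaProduct_d44_v238050dc1 hI, localTamagawa_five_238050dc1 hI]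
  have hqN : 5 ∣ (⟨1, -1, 0, -2873742, -1877479084⟩ : WeierstrassCurve ℚ).conductorNorm ℤ := by rw [hN]; norm_num
  have hCM : ¬ (⟨1, -1, 0, -2873742, -1877479084⟩ : WeierstrassCurve ℚ).HasCM := fun hCM ↦ by
    have hj := (WeierstrassCurve.hasCM_iff_j_mem_holds (⟨1, -1, 0, -2873742, -1877479084⟩ : WeierstrassCurve ℚ)).1 hCM
    rw [WeierstrassCurve.j, Units.val_inv_eq_inv_val, WeierstrassCurve.coe_Δ'] at hj
    simp only [cmJInvariants, Finset.mem_insert, Finset.mem_singleton] at hj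
    norm_num [WeierstrassCurve.Δ, WeierstrassCurve.b₂, WeierstrassCurve.b₄, WeierstrassCurve.b₆, WeierstrassCurve.b₈,
      WeierstrassCurve.c₄] at hj
  have hGS := subGss_three_238050dc1 (W := (⟨1, -1, 0, -2873742, -1877479084⟩ : WeierstrassCurve ℚ)) rfl
  exact leafRankZeroUpper_three_monoCarrierAny_of_namedFacts_of_twistUnitZeroTwoSplit hGZ hKo hGZK hmod hMN hmodP hCassels h37 hPT hF1
    _ hCM hGS.1 hGS.2 hr 5 hqN hmono Dt hc hTU

/-! ## §22 `282240ex1` = `[0, 0, 0, 3087, 388962]`, `N = 282240 = 2^7·3^2·5·7^2` (`2`: II, `c = 1`, `3`: I₀*, `c = 2`, `5`: I3, `c = 1`, `7`: IV*, `c = 3`); `∏ c_ℓ = 6`, single carrier `q = 7` (IV*, ADDITIVE, `c_7 = 3`);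
`r_an = 0`, `#E(ℚ)_tors = 1`, `#Ш(E)_an = 1` (Cremona/LMFDB, displayed where used); class `282240ex` of size 1.
`V = E^{(-3)}_min = [0, 0, 0, 343, -14406]` (`#Ṽ(𝔽₃) = 4`), `K = ℚ(√-311)`, `Wd = E^{(-311)}_min = [0, 0, 0, 298577727, -11700066810222]`: `L(E^{(-311)},1) = 0` (root number `-1`), `L'(E^{(-311)},1) ≠ 0`, `X := L'(F,1)·T²/(Ω·∏c·ĥ(P)) = [F(ℚ):ℤP]²·#Ш(F)_an = 1` EXACTLY (an integer to `64` digits) with the Heegner point `P ∈ F(ℚ)` of canonical height `ĥ(P) = 37.547826` found by the level-`N` engine (g12 `heeg2.gp`, kit j312623; `N(Wd) = 27298535040 = N·311²`, `∏c(Wd) = 12`, `#Wd(ℚ)_tors = 1`), whence `ord₃ #Ш(Wd)_an ≤ 0`. -/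

/-- `V = [0, 0, 0, 343, -14406]` (the minimal model of `282240ex1^{(-3)}`, conductor `31360`): `Δ ≠ 0` in the kernel. [cite: Cremona2006, Table 1 (Cremona label 282240ex1)] -/
theorem isElliptic_sV282240ex1 : (⟨0, 0, 0, 343, -14406⟩ : WeierstrassCurve ℚ).IsElliptic :=
  isElliptic_of_discOf_ne_zero 0 0 0 343 (-14406) (by decide +kernel)

/-- `V` is globally minimal: `|Δ| = 2^7·5^3·7^8` kernel-checked, Kraus' criterion prime by prime. [cite: Kraus1989, Prop. 1 and Prop. 2]
[cite: SilvermanAEC2009, VII.1 Remark 1.1] [cite: Cremona2006, Table 1 (Cremona label 282240ex1)] -/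
theorem isGloballyMinimal_sV282240ex1 : (⟨0, 0, 0, 343, -14406⟩ : WeierstrassCurve ℚ).IsGloballyMinimal :=
  isGloballyMinimal_of_krausCriterion₃_factored 0 0 0 343 (-14406)
    [(2, 7), (5, 3), (7, 8)] (by decide +kernel)
    (by intro qe hqe; simp only [List.mem_cons, List.not_mem_nil, or_false] at hqe
        rcases hqe with rfl | rfl | rfl <;> norm_num)
    (by set_option synthInstance.maxSize 2000 in decide +kernel)

/-- **`282240ex1` is ADDITIVE at `3` and on the cell (G) ∧ ss, IN THE KERNEL**: `3 ∣ Δ`, `3 ∣ c₄`; `C • V^{(-3)} = E` (`[u, r, s, t] = [1, 0, 0, 0]`) with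
`V` globally minimal, `3 ∤ Δ(V)`, `#Ṽ(𝔽₃) = 4` (`a₃(V) = 0`, supersingular), whence `TypeG`, `SubGord`, `SubGss` at `3` as in the k1 records.
[cite: SilvermanAEC2009, VII.5 Prop. 5.1 (a), (c)] [cite: Delbourgo1998, §1.5 (G)] [cite: Cremona2006, Table 1 (Cremona label 282240ex1)] -/
theorem subGss_three_282240ex1 {W : WeierstrassCurve ℚ} [W.IsElliptic] [W.IsGloballyMinimal] (hWeq : W = (⟨0, 0, 0, 3087, 388962⟩ : WeierstrassCurve ℚ)) :
    Addv W 3 ∧ SubGss W 3 := by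
  subst hWeq
  haveI := isElliptic_sV282240ex1
  haveI := isGloballyMinimal_sV282240ex1
  have hIW : integralModelInt (⟨0, 0, 0, 3087, 388962⟩ : WeierstrassCurve ℚ) = (⟨0, 0, 0, 3087, 388962⟩ : WeierstrassCurve ℤ) :=
    integralModelInt_eq_of_map_eq _ (map_mk_int 0 0 0 3087 388962)
  have hadd : Addv (⟨0, 0, 0, 3087, 388962⟩ : WeierstrassCurve ℚ) 3 := Additive.addv_of_intModel hIW 3 (by decide +kernel) (by decide +kernel)
  have hIV : integralModelInt (⟨0, 0, 0, 343, -14406⟩ : WeierstrassCurve ℚ) = (⟨0, 0, 0, 343, -14406⟩ : WeierstrassCurve ℤ) :=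
    integralModelInt_eq_of_map_eq _ (map_mk_int 0 0 0 343 (-14406))
  have hcV : Nat.card ((((⟨0, 0, 0, 343, -14406⟩ : WeierstrassCurve ℤ)).map (Int.castRingHom (ZMod 3))).toAffine.Point) = 4 := by
    have h := natCard_point_eq_countPoints 0 0 0 343 (-14406) 3 (by norm_num) (by decide +kernel)
    have h' : countPoints [0, 0, 0, 343, -14406] 3 = 4 := countPoints_eq_of_fast (by decide +kernel)
    exact_mod_cast h.trans h'
  have hgood : GoodSS (⟨0, 0, 0, 343, -14406⟩ : WeierstrassCurve ℚ) 3 := Supersingular.goodSS_of_intModel 3 hIV (by decide +kernel) hcV (by decide)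
  have hVW : (⟨1, (0 : ℚ), (0 : ℚ), (0 : ℚ)⟩ : VariableChange ℚ) • (⟨0, 0, 0, 343, -14406⟩ : WeierstrassCurve ℚ).quadraticTwist (-3) =
      (⟨0, 0, 0, 3087, 388962⟩ : WeierstrassCurve ℚ) := by
    ext <;> simp [WeierstrassCurve.variableChange_a₁, WeierstrassCurve.variableChange_a₂,
      WeierstrassCurve.variableChange_a₃, WeierstrassCurve.variableChange_a₄, WeierstrassCurve.variableChange_a₆,
      WeierstrassCurve.quadraticTwist, WeierstrassCurve.b₂, WeierstrassCurve.b₄, WeierstrassCurve.b₆] <;> norm_num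
  obtain ⟨C, hC⟩ := exists_variableChange_quadraticTwist_symm (⟨0, 0, 0, 3087, 388962⟩ : WeierstrassCurve ℚ)
    (⟨0, 0, 0, 343, -14406⟩ : WeierstrassCurve ℚ) (d := (-3 : ℚ)) (by norm_num) ⟨_, hVW⟩
  have hC' : C • (⟨0, 0, 0, 3087, 388962⟩ : WeierstrassCurve ℚ).quadraticTwist ((-1 : ℚ) ^ ((3 : ℕ) / 2) * (3 : ℕ)) =
      (⟨0, 0, 0, 343, -14406⟩ : WeierstrassCurve ℚ) := by
    rw [O5.pstar_three]; exact hC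
  have hG : TypeG (⟨0, 0, 0, 3087, 388962⟩ : WeierstrassCurve ℚ) 3 := (typeG_three_iff_good_twist _ hadd _ C hC').mpr hgood.1
  exact ⟨hadd, (O5.subGss_three_iff_subGord_and_goodSS_twist _ hadd _ C hC).mpr
    ⟨subGord_three_of_typeG_of_addv _ hG hadd, hgood⟩⟩

/-- Row certificate of `282240ex1` (stage-1 `TamLocal` at every bad prime, stage-2 `TamX` at the `IV`/`IV*` prime, stage-3 `TamZ` at the `I₀*`/`Iₙ*` primes):
checks in the kernel; emitted by n1011-p03 `tools/tamcert.py`, unchanged. [cite: Silverman1994, IV.9.4 Steps 2–7] [cite: Tate1975, §7] [cite: Cremona2006, Table 1 (Cremona label 282240ex1)] -/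
theorem tamRowZ_282240ex1 :
    TamZ.rowCheckZ [⟨2, 1, 4, 0, 1, 0, 0, 7, 2, 1, 1⟩, ⟨3, 1, 5, 0, 0, 0, 0, 6, 6, 0, 2⟩, ⟨5, 2, 3, 0, 0, 0, 0, 3, 0, 0, 1⟩, ⟨7, 2, 5, 0, 0, 0, 0, 8, 8, 0, 3⟩]
      [⟨7, 2, 3, 0, 0, 0, 8, 1⟩] [⟨3, 9, 0, 0, 0, 6, 0, 1⟩] (⟨0, 0, 0, 3087, 388962⟩ : WeierstrassCurve ℤ) = true := by
  decide +kernel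

/-- **`∏_ℓ c_ℓ(282240ex1) = 6` IN THE KERNEL** for any globally minimal `W / ℚ` with this integral model (Cremona: `6`; `ord₃ = 1`). [cite: Silverman1994, IV.9.4] -/
theorem tamagawaProduct_282240ex1 {W : WeierstrassCurve ℚ} [W.IsGloballyMinimal]
    (hI : integralModelInt W = (⟨0, 0, 0, 3087, 388962⟩ : WeierstrassCurve ℤ)) : W.tamagawaProduct = 6 :=
  (IntModelTam.tamagawaProduct_eq_rowValueZ_of_intModel hI tamRowZ_282240ex1 (by decide +kernel)).trans (by decide +kernel)

/-- **`c(W/ℚ_7) = 3` IN THE KERNEL** (the carrier's LOCAL Tamagawa number) for any globally minimal `W / ℚ` with this model: Tate's algorithm at `7` to its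
exit (type IV*, `TamX` certificate, `c = 3`) through n1011-p19's bridge `IntModelTam.localTamagawaNumber_padic_eq_of_intModel_of_tamX`; the `hmono` input of the
mono-carrier road (`ord₃ ∏ c_ℓ = 1 = ord₃ c_7`). [cite: Silverman1994, IV.9.4] [cite: Tate1975, §7] [cite: Cremona2006, Table 1 (Cremona label 282240ex1)] -/
theorem localTamagawa_seven_282240ex1 {W : WeierstrassCurve ℚ} [W.IsElliptic] [W.IsGloballyMinimal]
    (hI : integralModelInt W = (⟨0, 0, 0, 3087, 388962⟩ : WeierstrassCurve ℤ)) :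
    haveI : Fact (Nat.Prime 7) := ⟨by norm_num⟩
    (W.baseChange ℚ_[7]).localTamagawaNumber ℤ_[7] = 3 :=
  haveI : Fact (Nat.Prime 7) := ⟨by norm_num⟩
  (IntModelTam.localTamagawaNumber_padic_eq_of_intModel_of_tamX hI 7 (F := ⟨7, 2, 3, 0, 0, 0, 8, 1⟩) rfl (by decide +kernel)).trans (by decide)

/-- `Wd = [0, 0, 0, 298577727, -11700066810222]` (the minimal model of the Heegner twist `282240ex1^{(-311)}`, conductor `27298535040`): `Δ ≠ 0` in the kernel. [cite: Cremona2006, Table 1 (Cremona label 282240ex1)] -/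
theorem isElliptic_sWd282240ex1 : (⟨0, 0, 0, 298577727, -11700066810222⟩ : WeierstrassCurve ℚ).IsElliptic :=
  isElliptic_of_discOf_ne_zero 0 0 0 298577727 (-11700066810222) (by decide +kernel)

/-- `Wd` is globally minimal: `|Δ| = 2^7·3^6·5^3·7^8·311^6` kernel-checked, Kraus' criterion prime by prime. [cite: Kraus1989, Prop. 1 and Prop. 2]
[cite: SilvermanAEC2009, VII.1 Remark 1.1] [cite: Cremona2006, Table 1 (Cremona label 282240ex1)] -/
theorem isGloballyMinimal_sWd282240ex1 : (⟨0, 0, 0, 298577727, -11700066810222⟩ : WeierstrassCurve ℚ).IsGloballyMinimal :=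
  isGloballyMinimal_of_krausCriterion₃_factored 0 0 0 298577727 (-11700066810222)
    [(2, 7), (3, 6), (5, 3), (7, 8), (311, 6)] (by decide +kernel)
    (by intro qe hqe; simp only [List.mem_cons, List.not_mem_nil, or_false] at hqe
        rcases hqe with rfl | rfl | rfl | rfl | rfl <;> norm_num)
    (by set_option synthInstance.maxSize 2000 in decide +kernel)

/-- **U₀ AT `282240ex1` BY THE MONO-CARRIER TWIST-UNIT ROAD** — `MissingUpperBoundAt W 3` (`ord₃ #Ш(E) ≤ ord₃ #Ш(E)_an`) at `W = E` (`r_an = 0`) from rhp-p2 g9 §4₀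
`RamifiedPairUpperBound.leafRankZeroUpper_three_monoCarrierAny_of_namedFacts_of_twistUnitZeroTwoSplit` (p646215): PRINTED binders `hGZ hKo hGZK hmod hMN hmodP hCassels`
(Gross–Zagier ∀, Kolyvagin ∀, GZK, Version L, Matar–Nekovář 2019 Thm 0.7 irreducible form, modular parametrisations exist, Cassels) and the three NAMED tree facts
`h37 hPT hF1` (GrossLMS1991 Prop. 3.7(2), Poitou–Tate for Selmer structures, Gross 1991 (4.1) — research-level, displayed BY NAME); KERNEL: `∏ c_ℓ(E) = 6`
(`tamagawaProduct_282240ex1`) and `c(E/ℚ_7) = 3` (`localTamagawa_seven_282240ex1`): `hmono` with the single ADDITIVE carrier `q = 7` (IV*); `¬ CM` (`j = 6048/125`),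
`Addv ∧ SubGss` at `3` (`subGss_three_282240ex1`), the field `K = ℚ(√-311)` (`-311 ≡ 1 (mod 8)`; `311` prime), the twist identity
`Cd • E^{(-311)} = Wd` (`Cd = [1, 0, 0, 0]`), Kraus minimality of `Wd` (`isGloballyMinimal_sWd282240ex1`); DISPLAYED: `N(E) = 282240` (`hN`), `r_an(E) = 0` (`hr`), `Dt` with
`3 ∤ c(Dt)` (`hc`; Manin constant `1` for this optimal curve), `L(E^{(-311)},1) = 0` (`hL0`), `L'(E^{(-311)},1) ≠ 0` (`hL1`), `ord₃ #Ш(Wd)_an ≤ 0` (`hqd`/`hvd`; `X = 1`) — numerics in the section header.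
A per-curve certificate; U₀ (stmt 26024) stays OPEN class-wide; BSD is NOT proved by this. [cite: MatarNekovar2019, Thm. 0.7 (p. 456) and §0.11 (p. 457)]
[cite: GrossZagier1986, Thm. I.(6.3)] [cite: GrossLMS1991, Prop. 3.7] [cite: Miller2011LMS, Def. 1.1] [cite: Cremona2006, Table 1 (Cremona label 282240ex1)] -/
theorem u0_at_282240ex1
    (hGZ : ∀ (N : ℕ) [NeZero N] (W : WeierstrassCurve ℚ) (K : Type) [Field K] [NumberField K], gross_zagier N W K)
    (hKo : ∀ (N : ℕ) [NeZero N] (W : WeierstrassCurve ℚ) (K : Type) [Field K] [NumberField K], kolyvagin N W K)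
    (hGZK : rank_eq_analyticRank_of_analyticRank_le_one) (hmod : hasEntireLFunction_rat)
    (hMN : MatarNekovar2019.thm07_padicValNat_card_sha_primary_add_le_of_globalDivisibility_of_irreducible) (hmodP : nonempty_modularParametrizationData)
    (hCassels : bsdRHS_eq_of_isIsogenous) (h37 : GrossLMS1991.prop37_2_frobeniusCongruence)
    (hPT : ∀ (K : Type) [Field K] [NumberField K], Literature.NumberTheory.GaloisCohomology.poitouTate_selmerStructure_duality_conj K)
    (hF1 : Gross1991_heegnerPoint_sub_ratTorsion_mem_E0_imageFree)
    {W : WeierstrassCurve ℚ} [W.IsElliptic] [W.IsGloballyMinimal] (hWeq : W = (⟨0, 0, 0, 3087, 388962⟩ : WeierstrassCurve ℚ))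
    (hN : W.conductorNorm ℤ = 282240) [NeZero (W.conductorNorm ℤ)] (hr : W.analyticRank = 0)
    (Dt : ModularParametrizationData W (W.conductorNorm ℤ)) (hc : ¬ (3 : ℤ) ∣ Dt.c)
    (hL0 : (W.quadraticTwist ((-311 : ℤ) : ℚ)).entireLFunction 1 = 0)
    (hL1 : deriv (W.quadraticTwist ((-311 : ℤ) : ℚ)).entireLFunction 1 ≠ 0)
    {qd : ℚ} (hqd : haveI := isElliptic_sWd282240ex1; shaAn (⟨0, 0, 0, 298577727, -11700066810222⟩ : WeierstrassCurve ℚ) = (qd : ℂ))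
    (hvd : padicValRat 3 qd ≤ 0) :
    MissingUpperBoundAt W 3 := by
  subst hWeq
  haveI := isElliptic_sWd282240ex1; haveI := isGloballyMinimal_sWd282240ex1
  haveI : Fact ((-311 : ℤ) < 0) := ⟨by norm_num⟩
  haveI : Fact (Nat.Prime 7) := ⟨by norm_num⟩
  have hjac : ∀ ℓ : ℕ, ℓ.Prime → ℓ ∣ 282240 → ℓ ≠ 2 → jacobiSym (-311) ℓ = 1 := by
    intro ℓ hℓ hℓN hℓ2
    have hmem : ℓ ∈ Nat.primeFactors 282240 := Nat.mem_primeFactors.mpr ⟨hℓ, hℓN, by norm_num⟩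
    have hpf : Nat.primeFactors 282240 = {2, 3, 5, 7} := by decide +kernel
    rw [hpf] at hmem
    simp only [Finset.mem_insert, Finset.mem_singleton] at hmem
    rcases hmem with rfl | rfl | rfl | rfl
    · exact absurd rfl hℓ2
    all_goals (rw [jacobiSym.mod_left]; norm_num [jacobiSym.mod_left])
  have hWd : (⟨1, (0 : ℚ), (0 : ℚ), (0 : ℚ)⟩ : VariableChange ℚ) •
      (⟨0, 0, 0, 3087, 388962⟩ : WeierstrassCurve ℚ).quadraticTwist ((-311 : ℤ) : ℚ) =
        (⟨0, 0, 0, 298577727, -11700066810222⟩ : WeierstrassCurve ℚ) := by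
    push_cast
    ext <;> simp [WeierstrassCurve.variableChange_a₁, WeierstrassCurve.variableChange_a₂,
      WeierstrassCurve.variableChange_a₃, WeierstrassCurve.variableChange_a₄, WeierstrassCurve.variableChange_a₆,
      WeierstrassCurve.quadraticTwist, WeierstrassCurve.b₂, WeierstrassCurve.b₄, WeierstrassCurve.b₆] <;> norm_num
  have hTU := twistUnitZeroTwoSplit_of_sqrtField _ 282240 (-311) (by norm_num)
    (by rw [show (-311 : ℤ).natAbs = 311 by rfl, Nat.squarefree_iff_nodup_primeFactorsList (by norm_num)]; simp)
    hjac hN hL0 hL1 _ _ hWd hqd hvd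
  have hI : integralModelInt (⟨0, 0, 0, 3087, 388962⟩ : WeierstrassCurve ℚ) = (⟨0, 0, 0, 3087, 388962⟩ : WeierstrassCurve ℤ) :=
    integralModelInt_eq_of_map_eq _ (map_mk_int 0 0 0 3087 388962)
  have hmono : padicValNat 3 (⟨0, 0, 0, 3087, 388962⟩ : WeierstrassCurve ℚ).tamagawaProduct ≤
      padicValNat 3 (((⟨0, 0, 0, 3087, 388962⟩ : WeierstrassCurve ℚ).baseChange ℚ_[7]).localTamagawaNumber ℤ_[7]) := by
    rw [tamagawaProduct_282240ex1 hI, localTamagawa_seven_282240ex1 hI]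
    exact le_of_eq (IntModelTam.padicValNat_eq_padicValNat_of_eq_mul (m := 2) Nat.prime_three (by norm_num) (by norm_num) (by norm_num))
  have hqN : 7 ∣ (⟨0, 0, 0, 3087, 388962⟩ : WeierstrassCurve ℚ).conductorNorm ℤ := by rw [hN]; norm_num
  have hCM : ¬ (⟨0, 0, 0, 3087, 388962⟩ : WeierstrassCurve ℚ).HasCM := fun hCM ↦ by
    have hj := (WeierstrassCurve.hasCM_iff_j_mem_holds (⟨0, 0, 0, 3087, 388962⟩ : WeierstrassCurve ℚ)).1 hCM
    rw [WeierstrassCurve.j, Units.val_inv_eq_inv_val, WeierstrassCurve.coe_Δ'] at hj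
    simp only [cmJInvariants, Finset.mem_insert, Finset.mem_singleton] at hj
    norm_num [WeierstrassCurve.Δ, WeierstrassCurve.b₂, WeierstrassCurve.b₄, WeierstrassCurve.b₆, WeierstrassCurve.b₈,
      WeierstrassCurve.c₄] at hj
  have hGS := subGss_three_282240ex1 (W := (⟨0, 0, 0, 3087, 388962⟩ : WeierstrassCurve ℚ)) rfl
  exact leafRankZeroUpper_three_monoCarrierAny_of_namedFacts_of_twistUnitZeroTwoSplit hGZ hKo hGZK hmod hMN hmodP hCassels h37 hPT hF1
    _ hCM hGS.1 hGS.2 hr 7 hqN hmono Dt hc hTU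

/-- **BSD₃ AT `282240ex1` modulo print, the named facts and displayed numerics** — `BSDp W 3` from `u0_at_282240ex1` (upper half) and the LOWER half read off the
displayed analytic order `#Ш(E)_an = q` with `ord₃ q ≤ 0` (Cremona: `#Ш(E)_an = 1`, so `ord₃ q ≤ 0 ≤ ord₃ #Ш(E)` is free), glued by `Typed.missingPPartAt_of_lower_of_upper`
+ `Typed.bsdp_of_missingPPartAt` (GZK).  Per curve, CONDITIONAL on every displayed input; nothing booked; BSD is NOT proved by this.
[cite: Miller2011LMS, Def. 1.1] [cite: MatarNekovar2019, Thm. 0.7 (p. 456)] [cite: Cremona2006, Table 1 (Cremona label 282240ex1)] -/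
theorem bsd3_at_282240ex1
    (hGZ : ∀ (N : ℕ) [NeZero N] (W : WeierstrassCurve ℚ) (K : Type) [Field K] [NumberField K], gross_zagier N W K)
    (hKo : ∀ (N : ℕ) [NeZero N] (W : WeierstrassCurve ℚ) (K : Type) [Field K] [NumberField K], kolyvagin N W K)
    (hGZK : rank_eq_analyticRank_of_analyticRank_le_one) (hmod : hasEntireLFunction_rat)
    (hMN : MatarNekovar2019.thm07_padicValNat_card_sha_primary_add_le_of_globalDivisibility_of_irreducible) (hmodP : nonempty_modularParametrizationData)
    (hCassels : bsdRHS_eq_of_isIsogenous) (h37 : GrossLMS1991.prop37_2_frobeniusCongruence)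
    (hPT : ∀ (K : Type) [Field K] [NumberField K], Literature.NumberTheory.GaloisCohomology.poitouTate_selmerStructure_duality_conj K)
    (hF1 : Gross1991_heegnerPoint_sub_ratTorsion_mem_E0_imageFree)
    {W : WeierstrassCurve ℚ} [W.IsElliptic] [W.IsGloballyMinimal] (hWeq : W = (⟨0, 0, 0, 3087, 388962⟩ : WeierstrassCurve ℚ))
    (hN : W.conductorNorm ℤ = 282240) [NeZero (W.conductorNorm ℤ)] (hr : W.analyticRank = 0)
    {q : ℚ} (hq : shaAn W = (q : ℂ)) (hv : padicValRat 3 q ≤ 0)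
    (Dt : ModularParametrizationData W (W.conductorNorm ℤ)) (hc : ¬ (3 : ℤ) ∣ Dt.c)
    (hL0 : (W.quadraticTwist ((-311 : ℤ) : ℚ)).entireLFunction 1 = 0)
    (hL1 : deriv (W.quadraticTwist ((-311 : ℤ) : ℚ)).entireLFunction 1 ≠ 0)
    {qd : ℚ} (hqd : haveI := isElliptic_sWd282240ex1; shaAn (⟨0, 0, 0, 298577727, -11700066810222⟩ : WeierstrassCurve ℚ) = (qd : ℂ))
    (hvd : padicValRat 3 qd ≤ 0) :
    BSDp W 3 := by
  have hup : MissingUpperBoundAt W 3 := u0_at_282240ex1 hGZ hKo hGZK hmod hMN hmodP hCassels h37 hPT hF1 hWeq hN hr Dt hc hL0 hL1 hqd hvd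
  have hlow : MissingLowerBoundAt W 3 := ⟨q, hq, hv.trans (by exact_mod_cast Nat.zero_le _)⟩
  exact Typed.bsdp_of_missingPPartAt _ 3 hGZK (by rw [hr]; exact zero_le_one) (Typed.missingPPartAt_of_lower_of_upper _ 3 hlow hup)

end Summit.BirchSwinnertonDyer.BirchSwinnertonDyer.Theorems.RamifiedHeegnerPairTwistUnitAdditive

end
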